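import Summits.HodgeConjecture.HodgeConjecture.Theorems.PadicSemiregularLiftHodgeFermatVarietiesPairedOfLargePrimesSharp
import Summits.HodgeConjecture.HodgeConjecture.Theorems.PadicSemiregularLiftHodgeFermatVarietiesFibreOfBoundaryNat
import Literature.AlgebraicGeometry.HodgeTheory.FermatShiodaCondition
import HarnessLib

/-!
# A non-paired Hodge sextuple at a level prime to `6` has a full `5`-fibre at its top non-even level — line `cancel-by-any-claim-lattice`, crux `HodgeFermatVarieties` (stmt-HodgeConjecture-1334)

Lead c4's programme S16 (classification of the Hodge sextuples of `ℤ/m`, `(m, 6) = 1`: three pairs or Aoki's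
`σ_{5,A}`), stub S16-L2a `stub_fibre_of_top_level` (THE LEVEL ANALYSIS). Setting: a Hodge character
`α : Fin 6 → ℤ/m`, `(m, 6) = 1`, `25 ∤ m`, `35 ∤ m`; for a level `M ∣ m` write
`cnt_M(u) = #{i : level(αᵢ) = M, unit part of αᵢ = u}` (`αᵢ = (m/M)·⟨uᵢ⟩`, lead c2's `unitPart_spec`).
THEOREM: if `cnt_M` is not even while `cnt_{M'}` is even at every proper multiple `M'` of `M`, then `M = 5n` with
`5 ∤ n`, `n > 1`, and for some unit `b` mod `n` the whole fibre `{crt⁻¹(y, b) : y ∈ (ℤ/5)ˣ}` consists of unit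
parts of level-`M` entries of `α`.

Proof (Aoki's level analysis with the prime `5` at the boundary; every brick is a landed theorem of lead c2's
`PairedNull` files): Aoki's criterion at conductor `M` and the evenness above `M`
(`sum_level_eq_zero_of_criterion`) make `T = cnt_M` orthogonal to the odd primitive characters mod `M`; since `T`
is not even, the refined counting `even_of_oddNull'` leaves a prime `p ∣ M` without room, `p ∈ {5, 7}` as
`#supp T ≤ 6`. `p = 7`: six distinct unit entries at level `M`; `35 ∤ m` gives `5 ∤ M`, so `7` is the least prime of
`M` and the failed clause gives `49 ∤ M`; `M = 7` is excluded by `even_of_oddNull_prime`, and `M = 7n'`, `n' > 1`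
(primes `≥ 11`) by `even_or_fibre_of_boundary` plus Aoki's criterion at conductor `n'` (`χ(7) = 1` for all odd
primitive `χ` mod `n'`, impossible: `exists_odd_isPrimitive_apply_natCast_ne_one`) — word for word the boundary case
of `level_count_even_sharp`. `p = 5`: `25 ∤ m` gives `M = 5n`, `5 ∤ n`; `n = 1` is a prime level; `35 ∤ m` makes the
primes of `n` at least `11`, so the ℕ-valued dichotomy `stub_fibre_of_boundary_nat` (S16-L1) applies: `T` even
(excluded) or a full fibre inside the support.

References: [Aoki1983] N. Aoki, Math. Ann. 266 (1983) 23–54, Thm. A′ (§7), Prop. 2.2, Prop. 6.1, Prop. 6.4.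
-/

-- every sibling file of the line declares into `…CancelByAnyClaimLattice.PairedNull` from a differently named module
set_option linter.dupNamespace false

noncomputable section

open Finset
open Literature.AlgebraicGeometry.HodgeTheory Literature.AlgebraicGeometry.HodgeTheory.FermatCharacter

namespace Summit.HodgeConjecture.HodgeConjecture.Theorems.CancelByAnyClaimLattice

namespace PairedNull

section TopLevel

variable {m : ℕ} [NeZero m] {α : Fin 6 → ZMod m}

/-- **The level analysis of the programme S16** (section-variable form; see the module docstring). [cite: Aoki1983, Thm. A′ (§7), Prop. 2.2, Prop. 6.4] -/
theorem fibre_of_top_level (hm6 : m.Coprime 6) (h25 : ¬ 25 ∣ m) (h35 : ¬ 35 ∣ m) (h : IsHodge α)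
    {M : ℕ} (hMm : M ∣ m)
    (hne : ∃ v : ZMod M,
      #(univ.filter fun i : Fin 6 ↦ m / m.gcd (α i).val = M ∧ ((((α i).val / (m / M)) : ℕ) : ZMod M) = -v) ≠
      #(univ.filter fun i : Fin 6 ↦ m / m.gcd (α i).val = M ∧ ((((α i).val / (m / M)) : ℕ) : ZMod M) = v))
    (hIH : ∀ M' : ℕ, M' ∣ m → M ∣ M' → M' ≠ M → ∀ u : ZMod M',
      #(univ.filter fun i : Fin 6 ↦ m / m.gcd (α i).val = M' ∧ ((((α i).val / (m / M')) : ℕ) : ZMod M') = -u) =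
      #(univ.filter fun i : Fin 6 ↦ m / m.gcd (α i).val = M' ∧ ((((α i).val / (m / M')) : ℕ) : ZMod M') = u)) :
    ∃ (n : ℕ) (hc : Nat.Coprime 5 n), M = 5 * n ∧ 1 < n ∧ ∃ b : ZMod n, IsUnit b ∧
      ∀ y : (ZMod 5)ˣ, ∃ i : Fin 6, m / m.gcd (α i).val = 5 * n ∧
        ((((α i).val / (m / (5 * n))) : ℕ) : ZMod (5 * n)) = (ZMod.chineseRemainder hc).symm ((y : ZMod 5), b) := by
  classical
  have hm0 : m ≠ 0 := NeZero.ne m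
  have hM0 : M ≠ 0 := fun h0 ↦ hm0 (by rw [h0] at hMm; exact zero_dvd_iff.mp hMm)
  haveI : NeZero M := ⟨hM0⟩
  -- the multiplicity function of the level-`M` unit parts
  set cnt : ZMod M → ℕ := fun u ↦
    #(univ.filter fun i : Fin 6 ↦ m / m.gcd (α i).val = M ∧ ((((α i).val / (m / M)) : ℕ) : ZMod M) = u) with hcnt
  set T : ZMod M → ℂ := fun u ↦ (cnt u : ℂ) with hT
  have hTnat : ∀ u, ∃ k : ℕ, T u = k := fun u ↦ ⟨cnt u, rfl⟩
  have hnotev : ¬ ∀ u, T (-u) = T u := by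
    intro hev
    obtain ⟨v, hv⟩ := hne
    apply hv
    have := hev v
    simp only [hT, Nat.cast_inj] at this
    exact this
  have hspec : ∀ i, IsUnit ((((α i).val / (m / (m / m.gcd (α i).val)) : ℕ) : ZMod (m / m.gcd (α i).val))) ∧
      ((m / (m / m.gcd (α i).val) : ℕ) : ZMod m) *
        ((ZMod.val ((((α i).val / (m / (m / m.gcd (α i).val)) : ℕ) : ZMod (m / m.gcd (α i).val))) : ℕ) : ZMod m)
          = α i :=
    fun i ↦ unitPart_spec (α i)
  have hcastM : ∀ (L : ℕ) (_ : L = M) (y : ZMod m),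
      (ZMod.cast ((((y.val / (m / L)) : ℕ) : ZMod L)) : ZMod M) = (((y.val / (m / M)) : ℕ) : ZMod M) := by
    intro L hL y; subst hL; exact ZMod.cast_id _ _
  have hcast : ∀ (L M' : ℕ) (_ : L = M') (hMM' : M ∣ M') (y : ZMod m),
      (ZMod.cast ((((y.val / (m / L)) : ℕ) : ZMod L)) : ZMod M) =
        ZMod.castHom hMM' (ZMod M) ((((y.val / (m / M')) : ℕ) : ZMod M')) := by
    intro L M' hL hMM' y; subst hL; rfl
  have hTu : ∀ u, ¬ IsUnit u → T u = 0 := by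
    intro u hu
    simp only [hT, Nat.cast_eq_zero, hcnt, Finset.card_eq_zero, Finset.filter_eq_empty_iff]
    intro i _ hi
    apply hu
    have hdvd : M ∣ m / m.gcd (α i).val := by rw [hi.1]
    rw [← hi.2, ← hcastM _ hi.1 (α i)]
    exact ((hspec i).1).map (ZMod.castHom hdvd (ZMod M))
  set I : Finset (Fin 6) := univ.filter fun i : Fin 6 ↦ m / m.gcd (α i).val = M with hI
  have hsupp_img : (univ.filter fun u : ZMod M ↦ T u ≠ 0) =
      I.image fun i ↦ ((((α i).val / (m / M)) : ℕ) : ZMod M) := by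
    ext u
    rw [mem_filter, mem_image]
    simp only [mem_univ, true_and, hT, Nat.cast_ne_zero, hcnt]
    rw [Finset.card_ne_zero]
    constructor
    · rintro ⟨i, hi⟩
      rw [mem_filter] at hi
      exact ⟨i, by rw [hI, mem_filter]; exact ⟨mem_univ _, hi.2.1⟩, hi.2.2⟩
    · rintro ⟨i, hi, hiu⟩
      rw [hI, mem_filter] at hi
      exact ⟨i, by rw [mem_filter]; exact ⟨mem_univ _, hi.2, hiu⟩⟩
  have hsuppR : #(univ.filter fun u : ZMod M ↦ T u ≠ 0) ≤ 6 := by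
    rw [hsupp_img]
    exact card_image_le.trans ((card_le_univ I).trans (by rw [Fintype.card_fin]))
  -- every prime of `m` (hence of `M`) is at least `5`
  have hm5 : ∀ p ∈ m.primeFactors, 5 ≤ p := by
    intro p hp
    have hpP := Nat.prime_of_mem_primeFactors hp
    have hpm := Nat.dvd_of_mem_primeFactors hp
    have h2 : p ≠ 2 := by
      rintro rfl; exact absurd (Nat.Coprime.coprime_dvd_left hpm hm6) (by norm_num)
    have h3 : p ≠ 3 := by
      rintro rfl; exact absurd (Nat.Coprime.coprime_dvd_left hpm hm6) (by norm_num)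
    have h4 : p ≠ 4 := by rintro rfl; exact absurd hpP (by decide)
    have := hpP.two_le
    omega
  have hM5 : ∀ p ∈ M.primeFactors, 5 ≤ p := fun p hp ↦ hm5 p (Nat.mem_primeFactors.mpr
    ⟨Nat.prime_of_mem_primeFactors hp, (Nat.dvd_of_mem_primeFactors hp).trans hMm, hm0⟩)
  haveI : ∀ i, NeZero (m / m.gcd (α i).val) := fun i ↦ ⟨(level_pos (α i)).ne'⟩
  -- Aoki's criterion at conductor `M`: `T` is orthogonal to the odd primitive characters mod `M`
  have hTodd : ∀ χ : DirichletCharacter ℂ M, χ.Odd → χ.IsPrimitive → ∑ u : ZMod M, T u * χ u = 0 := by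
    intro χ hχ hprim
    have key := h.aoki_criterion hMm hχ hprim (fun i ↦ m / m.gcd (α i).val) (fun i ↦ level_dvd (α i))
      (fun i ↦ ((((α i).val / (m / (m / m.gcd (α i).val)) : ℕ) : ZMod (m / m.gcd (α i).val))))
      (fun i ↦ (hspec i).1) (fun i ↦ (hspec i).2.symm)
    have hone : (∏ p ∈ M.primeFactors, (1 - χ p)) = 1 := by
      refine Finset.prod_eq_one fun p hp ↦ ?_
      have hnu : ¬ IsUnit ((p : ℕ) : ZMod M) := by
        rw [ZMod.isUnit_iff_coprime]
        exact fun hc ↦ (Nat.prime_of_mem_primeFactors hp).one_lt.ne'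
          (Nat.Coprime.eq_one_of_dvd hc (Nat.dvd_of_mem_primeFactors hp))
      rw [χ.map_nonunit hnu, sub_zero]
    have hA : (fun L : ℕ ↦ ((m.totient : ℂ) / (L.totient : ℂ)) * ∏ p ∈ L.primeFactors, (1 - χ p)) M ≠ 0 := by
      show ((m.totient : ℂ) / (M.totient : ℂ)) * ∏ p ∈ M.primeFactors, (1 - χ p) ≠ 0
      rw [hone, mul_one]
      exact div_ne_zero (by exact_mod_cast (Nat.totient_pos.mpr (NeZero.pos m)).ne')
        (by exact_mod_cast (Nat.totient_pos.mpr (NeZero.pos M)).ne')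
    have key' := sum_level_eq_zero_of_criterion χ hχ (fun i ↦ m / m.gcd (α i).val)
      (fun i ↦ (level_pos (α i)).ne')
      (fun i ↦ ((((α i).val / (m / (m / m.gcd (α i).val)) : ℕ) : ZMod (m / m.gcd (α i).val))))
      (fun L : ℕ ↦ ((m.totient : ℂ) / (L.totient : ℂ)) * ∏ p ∈ L.primeFactors, (1 - χ p)) hA key
      (fun i ↦ ((((α i).val / (m / M)) : ℕ) : ZMod M)) (fun i hi ↦ hcastM _ hi (α i))
      (fun L i ↦ ((((α i).val / (m / L)) : ℕ) : ZMod L)) (fun L hML i hiL ↦ hcast _ L hiL hML (α i))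
      (fun L ⟨i, hiL⟩ hML hLM u ↦ hIH L (hiL ▸ level_dvd (α i)) hML hLM u)
    rw [sum_comp_eq_sum_card_mul (univ.filter fun i : Fin 6 ↦ m / m.gcd (α i).val = M)
      (fun i ↦ ((((α i).val / (m / M)) : ℕ) : ZMod M)) (fun u ↦ (χ u)⁻¹)] at key'
    simp only [Finset.filter_filter] at key'
    have hconj : starRingEnd ℂ (∑ u : ZMod M, T u * χ u) = 0 := by
      rw [map_sum, ← key']
      refine Finset.sum_congr rfl fun u _ ↦ ?_
      rw [map_mul, hT, Complex.conj_natCast, char_inv_eq_conj]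
    have := congrArg (starRingEnd ℂ) hconj
    rwa [starRingEnd_self_apply, map_zero] at this
  -- the refined counting leaves a prime `p ∈ {5, 7}` of `M` without room
  have hbad : ∃ p ∈ M.primeFactors, ¬ (#(univ.filter fun u : ZMod M ↦ T u ≠ 0) + 1 < p ∨
      (p = M.minFac ∧ p * p ∣ M ∧ #(univ.filter fun u : ZMod M ↦ T u ≠ 0) < p)) := by
    by_contra hgood
    push Not at hgood
    exact hnotev (even_of_oddNull' hM5 T hTu hTodd fun p hp ↦ by
      have := hgood p hp; tauto)
  obtain ⟨p, hpmem, hpbad⟩ := hbad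
  have hp : p.Prime := Nat.prime_of_mem_primeFactors hpmem
  have hpM : p ∣ M := Nat.dvd_of_mem_primeFactors hpmem
  have hp5 : 5 ≤ p := hM5 p hpmem
  have hple : p ≤ #(univ.filter fun u : ZMod M ↦ T u ≠ 0) + 1 := by
    by_contra hlt; exact hpbad (Or.inl (by omega))
  have hp7 : p ≤ 7 := by omega
  have hp6 : p ≠ 6 := by rintro rfl; exact absurd hp (by decide)
  -- sum of the multiplicities over the support is at most `6`
  have hsum_cnt : ∑ u ∈ univ.filter (fun u : ZMod M ↦ T u ≠ 0), cnt u ≤ 6 := by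
    have hfib : ∑ u : ZMod M, cnt u = #I := by
      rw [hI, Finset.card_eq_sum_ones, ← Finset.sum_fiberwise_of_maps_to (t := univ)
        (g := fun i : Fin 6 ↦ ((((α i).val / (m / M)) : ℕ) : ZMod M)) (fun i _ ↦ mem_univ _)]
      refine Finset.sum_congr rfl fun u _ ↦ ?_
      rw [hcnt, Finset.sum_const, smul_eq_mul, mul_one, Finset.filter_filter]
    calc ∑ u ∈ univ.filter (fun u : ZMod M ↦ T u ≠ 0), cnt u ≤ ∑ u : ZMod M, cnt u :=
          Finset.sum_le_sum_of_subset (filter_subset _ _)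
      _ = #I := hfib
      _ ≤ 6 := (card_le_univ I).trans (by rw [Fintype.card_fin])
  have hge1 : ∀ u ∈ univ.filter (fun u : ZMod M ↦ T u ≠ 0), 1 ≤ cnt u := by
    intro u hu
    rw [mem_filter] at hu
    have : cnt u ≠ 0 := fun h0 ↦ hu.2 (by simp only [hT, h0, Nat.cast_zero])
    omega
  rcases (show p = 5 ∨ p = 7 by omega) with rfl | rfl
  · /- `p = 5`: `M = 5 n`, `5 ∤ n`, `n > 1`, primes of `n` ≥ 11, and the ℕ-valued dichotomy -/
    have h25M : ¬ 25 ∣ M := fun h' ↦ h25 (h'.trans hMm)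
    obtain ⟨n, rfl⟩ := hpM
    have hn0 : n ≠ 0 := fun h0 ↦ hM0 (by rw [h0, mul_zero])
    haveI : NeZero n := ⟨hn0⟩
    have h5n : ¬ 5 ∣ n := fun hd ↦ h25M (by obtain ⟨k, rfl⟩ := hd; exact ⟨k, by ring⟩)
    have hc : Nat.Coprime 5 n := (Nat.Prime.coprime_iff_not_dvd Nat.prime_five).mpr h5n
    have hn1 : n ≠ 1 := by
      intro hn1
      subst hn1
      exact hnotev (even_of_oddNull_prime (by rw [mul_one]; exact Nat.prime_five) T hTu hTodd)
    have hn5 : ∀ p' ∈ n.primeFactors, 5 ≤ p' := fun p' hp' ↦ hM5 p' (by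
      rw [Nat.primeFactors_mul (by norm_num) hn0]; exact mem_union_right _ hp')
    have hn11 : ∀ p' ∈ n.primeFactors, 11 ≤ p' := by
      intro p' hp'
      have hp'P := Nat.prime_of_mem_primeFactors hp'
      have hp'n := Nat.dvd_of_mem_primeFactors hp'
      have h5' := hn5 p' hp'
      have hne5 : p' ≠ 5 := fun he ↦ h5n (he ▸ hp'n)
      have hne7 : p' ≠ 7 := by
        intro he
        subst he
        exact h35 ((mul_dvd_mul_left 5 hp'n).trans hMm)
      have hne6 : p' ≠ 6 := by rintro rfl; exact absurd hp'P (by decide)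
      have hne8 : p' ≠ 8 := by rintro rfl; exact absurd hp'P (by decide)
      have hne9 : p' ≠ 9 := by rintro rfl; exact absurd hp'P (by decide)
      have hne10 : p' ≠ 10 := by rintro rfl; exact absurd hp'P (by decide)
      omega
    have hroom : ∀ p' ∈ n.primeFactors, #(univ.filter fun u : ZMod (5 * n) ↦ T u ≠ 0) + 1 < p' := by
      intro p' hp'; have := hn11 p' hp'; omega
    rcases stub_fibre_of_boundary_nat 5 n Nat.prime_five le_rfl h5n hn5 hc T hTnat hTu hTodd hroom with
      hev | ⟨b, hbu, hfib⟩
    · exact absurd hev hnotev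
    refine ⟨n, hc, rfl, by omega, b, hbu, fun y ↦ ?_⟩
    have hne0 : cnt ((ZMod.chineseRemainder hc).symm ((y : ZMod 5), b)) ≠ 0 := by
      have := hfib y
      simpa only [hT, Nat.cast_ne_zero] using this
    obtain ⟨i, hi⟩ := Finset.card_ne_zero.mp hne0
    rw [mem_filter] at hi
    exact ⟨i, hi.2.1, hi.2.2⟩
  · /- `p = 7`: six distinct unit entries at level `M = 7 n'`; the boundary case of Aoki's Thm A, a contradiction -/
    exfalso
    have hSR : #(univ.filter fun u : ZMod M ↦ T u ≠ 0) = 6 := le_antisymm hsuppR (by omega)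
    have h5M : ¬ 5 ∣ M := fun h5 ↦ h35 ((Nat.Coprime.mul_dvd_of_dvd_of_dvd (by norm_num) h5 hpM).trans hMm)
    have hmin : 7 = M.minFac := by
      have hM1 : M ≠ 1 := fun h1' ↦ by rw [h1'] at hpM; exact absurd (Nat.le_of_dvd one_pos hpM) (by norm_num)
      have h1 : M.minFac ≤ 7 := Nat.minFac_le_of_dvd (by norm_num) hpM
      have h2 : M.minFac ∈ M.primeFactors := Nat.mem_primeFactors.mpr ⟨Nat.minFac_prime hM1, Nat.minFac_dvd M, hM0⟩
      have h3 := hM5 _ h2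
      have h4 : M.minFac ≠ 5 := fun he ↦ h5M (he ▸ Nat.minFac_dvd M)
      have h6 : M.minFac ≠ 6 := fun he ↦ absurd (Nat.minFac_prime hM1) (by rw [he]; decide)
      omega
    have hsq : ¬ 7 * 7 ∣ M := fun hsq ↦ hpbad (Or.inr ⟨hmin, hsq, by omega⟩)
    obtain ⟨n, rfl⟩ := hpM
    have hn0 : n ≠ 0 := fun h0 ↦ hM0 (by rw [h0, mul_zero])
    haveI : NeZero n := ⟨hn0⟩
    have hp₀n : ¬ 7 ∣ n := fun hd ↦ hsq (mul_dvd_mul_left 7 hd)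
    have hn7 : ∀ p' ∈ n.primeFactors, 5 ≤ p' := fun p' hp' ↦ hM5 p' (by
      rw [Nat.primeFactors_mul (by norm_num) hn0]; exact mem_union_right _ hp')
    by_cases hn1 : n = 1
    · subst hn1
      exact hnotev (even_of_oddNull_prime (by rw [mul_one]; decide) T hTu hTodd)
    have hnbig : ∀ p' ∈ n.primeFactors, 7 + 1 < p' := by
      intro p' hp'
      have hp'P := Nat.prime_of_mem_primeFactors hp'
      have hp'n := Nat.dvd_of_mem_primeFactors hp'
      have h5' := hn7 p' hp'
      have hne5 : p' ≠ 5 := fun he ↦ h5M (he ▸ hp'n.trans (dvd_mul_left n 7))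
      have hne7 : p' ≠ 7 := fun he ↦ hp₀n (he ▸ hp'n)
      have hne6 : p' ≠ 6 := by rintro rfl; exact absurd hp'P (by decide)
      have hne8 : p' ≠ 8 := by rintro rfl; exact absurd hp'P (by decide)
      have hne9 : p' ≠ 9 := by rintro rfl; exact absurd hp'P (by decide)
      have hne10 : p' ≠ 10 := by rintro rfl; exact absurd hp'P (by decide)
      omega
    have hroom : ∀ p' ∈ n.primeFactors, #(univ.filter fun u : ZMod (7 * n) ↦ T u ≠ 0) + 1 < p' := by
      intro p' hp'; have := hnbig p' hp'; omega
    have h7 : Nat.Prime 7 := by decide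
    have hc : Nat.Coprime 7 n := (Nat.Prime.coprime_iff_not_dvd h7).mpr hp₀n
    -- `T` takes only the values `0, 1`
    have h01 : ∀ u, T u = 0 ∨ T u = 1 := by
      have hones : ∑ u ∈ univ.filter (fun u : ZMod (7 * n) ↦ T u ≠ 0), (1 : ℕ) = 6 := by
        rw [Finset.sum_const, smul_eq_mul, mul_one, hSR]
      have heq : ∀ u ∈ univ.filter (fun u : ZMod (7 * n) ↦ T u ≠ 0), cnt u = 1 := by
        have hle2 : ∑ u ∈ univ.filter (fun u : ZMod (7 * n) ↦ T u ≠ 0), cnt u ≤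
            ∑ u ∈ univ.filter (fun u : ZMod (7 * n) ↦ T u ≠ 0), (1 : ℕ) := by rw [hones]; exact hsum_cnt
        have := (Finset.sum_eq_sum_iff_of_le hge1).mp (le_antisymm (Finset.sum_le_sum hge1) hle2)
        exact fun u hu ↦ (this u hu).symm
      intro u
      by_cases hu : T u = 0
      · exact Or.inl hu
      · right
        have h1 := heq u (by rw [mem_filter]; exact ⟨mem_univ _, hu⟩)
        simp only [hT, h1, Nat.cast_one]
    rcases even_or_fibre_of_boundary h7 (by norm_num) hp₀n hn7 hc T h01 hTu hTodd hroom with hev | ⟨b, hbu, hfib⟩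
    · exact hnotev hev
    -- the full fibre: all six entries have level `7n` and `n`-residue `b`
    have hsupp_eq : (univ.filter fun u : ZMod (7 * n) ↦ T u ≠ 0) =
        (univ : Finset (ZMod 7)ˣ).image fun y : (ZMod 7)ˣ ↦ (ZMod.chineseRemainder hc).symm ((y : ZMod 7), b) := by
      symm
      apply Finset.eq_of_subset_of_card_le
      · intro u hu
        obtain ⟨y, -, rfl⟩ := mem_image.mp hu
        rw [mem_filter]
        exact ⟨mem_univ _, by rw [hfib y]; exact one_ne_zero⟩
      · rw [hSR, Finset.card_image_of_injective, Finset.card_univ, ZMod.card_units_eq_totient,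
          Nat.totient_prime h7]
        intro y y' hyy
        have := congrArg (ZMod.chineseRemainder hc) hyy
        simp only [RingEquiv.apply_symm_apply, Prod.mk.injEq] at this
        exact Units.ext this.1
    have hres : ∀ i : Fin 6, m / m.gcd (α i).val = 7 * n ∧
        ZMod.castHom (dvd_mul_left n 7) (ZMod n) ((((α i).val / (m / (7 * n))) : ℕ) : ZMod (7 * n)) = b := by
      have hIcard : #I = 6 := by
        refine le_antisymm ((card_le_univ I).trans (by rw [Fintype.card_fin])) ?_
        calc 6 = #(univ.filter fun u : ZMod (7 * n) ↦ T u ≠ 0) := hSR.symm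
          _ = #(I.image fun i ↦ ((((α i).val / (m / (7 * n))) : ℕ) : ZMod (7 * n))) := by rw [hsupp_img]
          _ ≤ #I := card_image_le
      have hIuniv : I = univ := Finset.eq_univ_of_card I (by rw [hIcard, Fintype.card_fin])
      intro i
      have hiI : i ∈ I := hIuniv ▸ mem_univ i
      have hlev : m / m.gcd (α i).val = 7 * n := (mem_filter.mp hiI).2
      refine ⟨hlev, ?_⟩
      have hmem : ((((α i).val / (m / (7 * n))) : ℕ) : ZMod (7 * n)) ∈
          univ.filter fun u : ZMod (7 * n) ↦ T u ≠ 0 := by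
        rw [hsupp_img]
        exact mem_image_of_mem _ hiI
      rw [hsupp_eq] at hmem
      obtain ⟨y, -, hy⟩ := mem_image.mp hmem
      rw [← hy, (castHom_crt_symm hc _ b).2]
    -- Aoki's criterion at `f = n`: `χ(7) = 1` for every odd primitive `χ` mod `n`
    have hnm : n ∣ m := (dvd_mul_left n 7).trans hMm
    have hall : ∀ χ : DirichletCharacter ℂ n, χ.Odd → χ.IsPrimitive → χ ((7 : ℕ) : ZMod n) = 1 := by
      intro χ hχ hprim
      have key := h.aoki_criterion hnm hχ hprim (fun i ↦ m / m.gcd (α i).val) (fun i ↦ level_dvd (α i))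
        (fun i ↦ ((((α i).val / (m / (m / m.gcd (α i).val)) : ℕ) : ZMod (m / m.gcd (α i).val))))
        (fun i ↦ (hspec i).1) (fun i ↦ (hspec i).2.symm)
      have hcastn : ∀ (L : ℕ) (_ : L = 7 * n) (y : ZMod m),
          (ZMod.cast ((((y.val / (m / L)) : ℕ) : ZMod L)) : ZMod n) =
            ZMod.castHom (dvd_mul_left n 7) (ZMod n) ((((y.val / (m / (7 * n))) : ℕ) : ZMod (7 * n))) := by
        intro L hL y; subst hL; rfl
      have hprod : (∏ p ∈ (7 * n).primeFactors, (1 - χ p)) = 1 - χ ((7 : ℕ) : ZMod n) := by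
        rw [Nat.primeFactors_mul (by norm_num) hn0, h7.primeFactors, Finset.prod_union,
          Finset.prod_singleton]
        · have hone : (∏ p ∈ n.primeFactors, (1 - χ p)) = 1 := by
            refine Finset.prod_eq_one fun p hp ↦ ?_
            have hnu : ¬ IsUnit ((p : ℕ) : ZMod n) := by
              rw [ZMod.isUnit_iff_coprime]
              exact fun hc' ↦ (Nat.prime_of_mem_primeFactors hp).one_lt.ne'
                (Nat.Coprime.eq_one_of_dvd hc' (Nat.dvd_of_mem_primeFactors hp))
            rw [χ.map_nonunit hnu, sub_zero]
          rw [hone, mul_one]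
        · rw [Finset.disjoint_singleton_left]
          exact fun hmem ↦ hp₀n (Nat.dvd_of_mem_primeFactors hmem)
      have hterm : ∀ i : Fin 6, (if n ∣ m / m.gcd (α i).val then
          ((m.totient : ℂ) / ((m / m.gcd (α i).val).totient : ℂ)) *
            (∏ p ∈ (m / m.gcd (α i).val).primeFactors, (1 - χ p)) *
            (χ (ZMod.cast ((((α i).val / (m / (m / m.gcd (α i).val))) : ℕ) : ZMod (m / m.gcd (α i).val)) : ZMod n))⁻¹
          else 0) =
          ((m.totient : ℂ) / ((7 * n).totient : ℂ)) * (1 - χ ((7 : ℕ) : ZMod n)) * (χ b)⁻¹ := by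
        intro i
        obtain ⟨hlev, hb⟩ := hres i
        rw [hcastn _ hlev (α i), hb, if_pos (hlev ▸ dvd_mul_left n 7), hlev, hprod]
      rw [Finset.sum_congr rfl fun i _ ↦ hterm i, Finset.sum_const, Finset.card_univ, Fintype.card_fin,
        nsmul_eq_mul] at key
      have hRne : ((6 : ℕ) : ℂ) ≠ 0 := by norm_num
      have hc₀ : (m.totient : ℂ) / ((7 * n).totient : ℂ) ≠ 0 :=
        div_ne_zero (by exact_mod_cast (Nat.totient_pos.mpr (NeZero.pos m)).ne')
          (by exact_mod_cast (Nat.totient_pos.mpr (NeZero.pos (7 * n))).ne')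
      have hχb0 : χ b ≠ 0 := by
        rw [← hbu.unit_spec]
        intro h0
        have := DirichletCharacter.unit_norm_eq_one χ hbu.unit
        rw [h0, norm_zero] at this
        exact zero_ne_one this
      have hχb : (χ b)⁻¹ ≠ 0 := inv_ne_zero hχb0
      rcases mul_eq_zero.mp key with h0 | h0
      · exact (hRne h0).elim
      · rcases mul_eq_zero.mp h0 with h0 | h0
        · rcases mul_eq_zero.mp h0 with h0 | h0
          · exact (hc₀ h0).elim
          · exact (sub_eq_zero.mp h0).symm
        · exact (hχb h0).elim
    have hnodd : Odd n := by
      rw [Nat.odd_iff]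
      by_contra h2
      have h2n : 2 ∣ n := Nat.dvd_of_mod_eq_zero (by omega)
      have := hn7 2 (Nat.mem_primeFactors.mpr ⟨Nat.prime_two, h2n, hn0⟩)
      omega
    obtain ⟨χ, hχo, hχp, hχne⟩ :=
      exists_odd_isPrimitive_apply_natCast_ne_one (n := n) (p₀ := 7) (by norm_num) hn1 hnodd hnbig hc
    exact hχne (hall χ hχo hχp)

end TopLevel

/-- **S16-L2a `stub_fibre_of_top_level` — THE LEVEL ANALYSIS** (registered form of `fibre_of_top_level`). [cite: Aoki1983, Thm. A′ (§7), Prop. 2.2, Prop. 6.4] -/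
theorem stub_fibre_of_top_level : ∀ {m : ℕ} [NeZero m] {α : Fin 6 → ZMod m}, m.Coprime 6 → ¬ 25 ∣ m → ¬ 35 ∣ m → FermatCharacter.IsHodge α → ∀ {M : ℕ}, M ∣ m → (∃ v : ZMod M, #(univ.filter fun i : Fin 6 ↦ m / m.gcd (α i).val = M ∧ ((((α i).val / (m / M)) : ℕ) : ZMod M) = -v) ≠ #(univ.filter fun i : Fin 6 ↦ m / m.gcd (α i).val = M ∧ ((((α i).val / (m / M)) : ℕ) : ZMod M) = v)) → (∀ M' : ℕ, M' ∣ m → M ∣ M' → M' ≠ M → ∀ u : ZMod M', #(univ.filter fun i : Fin 6 ↦ m / m.gcd (α i).val = M' ∧ ((((α i).val / (m / M')) : ℕ) : ZMod M') = -u) = #(univ.filter fun i : Fin 6 ↦ m / m.gcd (α i).val = M' ∧ ((((α i).val / (m / M')) : ℕ) : ZMod M') = u)) → ∃ (n : ℕ) (hc : Nat.Coprime 5 n), M = 5 * n ∧ 1 < n ∧ ∃ b : ZMod n, IsUnit b ∧ ∀ y : (ZMod 5)ˣ, ∃ i : Fin 6, m / m.gcd (α i).val = 5 * n ∧ ((((α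 i).val / (m / (5 * n))) : ℕ) : ZMod (5 * n)) = (ZMod.chineseRemainder hc).symm ((y : ZMod 5), b) :=
  fun hm6 h25 h35 h _ hMm hne hIH ↦ fibre_of_top_level hm6 h25 h35 h hMm hne hIH


end PairedNull

end Summit.HodgeConjecture.HodgeConjecture.Theorems.CancelByAnyClaimLattice

end
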